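import Mathlib
import Summits.CriticalPhenomena.SAWScalingLimit.Theorems.SAWMassiveIsingTiltCriticalCurveContinuityRestrictionSmallFugacity
import Summits.CriticalPhenomena.SAWScalingLimit.Theorems.SAWMassiveIsingTiltCriticalCurveContinuityExplicitKPRadius

/-!
# Restriction from mass with an explicit fugacity range (route `SAWMassiveIsingTilt`)

Route `SAWMassiveIsingTilt` of `CriticalPhenomena/SAWScalingLimit`; lead prover (c4) of the line
`registered` of the crux `CriticalCurveContinuity` (stmt-CriticalPhenomena-7686), cycle 4.

`zloop_restrictionDefect_le_smallFugacity` (p154796) proves the body of the sibling crux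
`RestrictionFromMass` (stmt-CriticalPhenomena-7687) with `C = 1`, `c = ½` for `y ∈ [0, y₀]`, where `y₀`
is the EXISTENCE-GRADE Kotecký–Preiss radius of `isSmallActivity_loopActivity` (`≈ 7.6·10⁻⁷`). Cycle 4
made the radius explicit (`isSmallActivity_loopActivity_of_norm_le`, p160172: `‖z‖ ≤ 1/13`). Here the
restriction argument is stated once for an ARBITRARY smallness radius
(`zloop_restrictionDefect_le_of_smallActivity`, proof = p154796's verbatim) and specialised:

**`zloop_restrictionDefect_le_thirteenth`** — for every `y ∈ [0, 1/13]`, every Dobrushin domain, mesh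
`δ > 0`, `S ⊆ V = vertices of Ω_δ` and hexagonal SAW `γ` with vertices in `S`,
`|log(Zloop(V∖γ)·Zloop(S)/(Zloop(S∖γ)·Zloop(V)))| ≤ Σ_{v ∈ γ} Σ_{w ∈ V∖S} e^{−½ d_Hex(v,w)}`:
the SmallFugacity layer of `RestrictionFromMass` on an explicit eighth of the critical interval
`[0, 1/√3)`.
-/

noncomputable section

open Finset Filter Topology
open Literature.Probability Literature.Probability.LatticeModels
  Literature.Probability.RandomPlanarGeometry
open Summit.CriticalPhenomena.SAWScalingLimit.Theses.SAWMassiveIsingTilt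
open Summit.CriticalPhenomena.SAWScalingLimit.Theorems.ObservableToSLE.Negative
  (finite_embMeshVertices_hex)
open scoped Classical

namespace Summit.CriticalPhenomena.SAWScalingLimit.Theorems.SAWMassiveIsingTilt

/-- **Restriction from mass from any Kotecký–Preiss radius.** If the cycle activities of the honeycomb
loop gas are `½`-small for all `‖z‖ ≤ y₀` (uniformly in the finite edge set), then for every
`y ∈ [0, y₀]` the four-term restriction defect is bounded by `Σ_{v∈γ} Σ_{w∈V∖S} e^{−½ d_Hex(v,w)}`
(the argument of `zloop_restrictionDefect_le_smallFugacity`, p154796, with the radius as a parameter). -/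
theorem zloop_restrictionDefect_le_of_smallActivity {y₀ : ℝ}
    (hsmallAll : ∀ (EH : Finset (Sym2 HexVertex)), (∀ e ∈ EH, e ∈ hexGraph.edgeSet) → ∀ z : ℂ, ‖z‖ ≤ y₀ →
      IsSmallActivity (fun A : Finset HexVertex => ∑ E ∈ EH.powerset with (E.biUnion Sym2.toFinset = A ∧
        A.Nonempty ∧ (∀ u : HexVertex, Even (E.filter (fun e => u ∈ e)).card) ∧
        ∀ u ∈ A, ∀ w ∈ A,
          (SimpleGraph.fromEdgeSet ((E : Finset (Sym2 HexVertex)) : Set (Sym2 HexVertex))).Reachable u w),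
        z ^ E.card) (1 / 2)) :
    ∀ y ∈ Set.Icc (0 : ℝ) y₀, ∀ (D : DobrushinDomain) (δ : ℝ), 0 < δ →
      ∀ (S : Set HexVertex) (a b : HexVertex) (γ : SAW.HexDomainSAW D.carrier δ a b),
        (∀ v ∈ γ.walk.support, v ∈ S) →
          S ⊆ SAW.embMeshDomain hexGraph hexCenter D.carrier δ →
            |Real.log ((Zloop (SAW.hexDomainGraph D.carrier δ)
                  (SAW.embMeshDomain hexGraph hexCenter D.carrier δ \ {v | v ∈ γ.walk.support}) y *
                Zloop (SAW.hexDomainGraph D.carrier δ) S y) /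
              (Zloop (SAW.hexDomainGraph D.carrier δ) (S \ {v | v ∈ γ.walk.support}) y *
                Zloop (SAW.hexDomainGraph D.carrier δ)
                  (SAW.embMeshDomain hexGraph hexCenter D.carrier δ) y))| ≤
              ∑ v ∈ γ.walk.support.toFinset,
                ∑ᶠ w ∈ SAW.embMeshDomain hexGraph hexCenter D.carrier δ \ S,
                  Real.exp (-((1 / 2) * (hexGraph.dist v w : ℝ))) := by
  intro y hy D δ hδ S a b γ hγS hSV
  have hΩ : Bornology.IsBounded D.carrier := D.isBounded
  have hδ0 : δ ≠ 0 := ne_of_gt hδ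
  -- notation
  set H := SAW.hexDomainGraph D.carrier δ with hH
  set V : Set HexVertex := SAW.embMeshDomain hexGraph hexCenter D.carrier δ with hV
  set Tγ : Set HexVertex := {v | v ∈ γ.walk.support} with hTγ
  set EH : Finset (Sym2 HexVertex) := (finite_edgeSet_hexDomainGraph hΩ hδ0).toFinset with hEH
  set W : Finset HexVertex := EH.biUnion Sym2.toFinset with hW
  set ρ : Finset HexVertex → ℂ := fun A => ∑ E ∈ EH.powerset with (E.biUnion Sym2.toFinset = A ∧
      A.Nonempty ∧ (∀ u : HexVertex, Even (E.filter (fun e => u ∈ e)).card) ∧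
      ∀ u ∈ A, ∀ w ∈ A,
        (SimpleGraph.fromEdgeSet ((E : Finset (Sym2 HexVertex)) : Set (Sym2 HexVertex))).Reachable u w),
    (y : ℂ) ^ E.card with hρ
  have hEHhex : ∀ e ∈ EH, e ∈ hexGraph.edgeSet := by
    intro e he
    rw [hEH, Set.Finite.mem_toFinset] at he
    exact SimpleGraph.edgeSet_mono (SAW.embDomainGraph_le hexGraph hexCenter D.carrier δ) he
  have hsmall : IsSmallActivity ρ (1 / 2) :=
    hsmallAll EH hEHhex (y : ℂ) (by rw [Complex.norm_real, Real.norm_eq_abs, abs_of_nonneg hy.1]; exact hy.2)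
  have hconn : ∀ A, ρ A ≠ 0 → IsRConnected hexGraph.Adj A :=
    fun A hA => isRConnected_of_loopActivity_ne_zero hEHhex (y : ℂ) A hA
  -- the four partition functions (`T_{S'}` = vertices of `E(Ω_δ)` in `S'`)
  have hZ : ∀ S' : Set HexVertex, ((Zloop H S' y : ℝ) : ℂ) =
      polymerPartitionFunction polyInc ρ (W.filter fun v => v ∈ S').powerset :=
    fun S' => zloop_eq_polymerPartitionFunction hΩ hδ0 S' y
  have hTST : (W.filter fun v => v ∈ S) ⊆ W.filter fun v => v ∈ V := by
    intro v hv
    rw [Finset.mem_filter] at hv ⊢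
    exact ⟨hv.1, hSV hv.2⟩
  -- positivity of the real partition functions and the ratio
  have hpos : ∀ S' : Set HexVertex, 0 < Zloop H S' y := fun S' =>
    lt_of_lt_of_le one_pos (one_le_zloop hΩ hδ0 hy.1 S')
  have hne : ∀ S' : Set HexVertex, ((Zloop H S' y : ℝ) : ℂ) ≠ 0 := fun S' =>
    Complex.ofReal_ne_zero.2 (hpos S').ne'
  set r : ℝ := Zloop H (V \ Tγ) y * Zloop H S y / (Zloop H (S \ Tγ) y * Zloop H V y) with hr
  have hrpos : 0 < r := div_pos (mul_pos (hpos _) (hpos _)) (mul_pos (hpos _) (hpos _))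
  -- the ratio through the cluster expansion: `r = exp(sS - sV)`
  have hrC : (r : ℂ) = Complex.exp
      ((∑ C ∈ (W.filter fun v => v ∈ S).powerset.powerset with
          (C ∩ (W.filter fun v => v ∈ V).powerset.filter fun A => ∃ v ∈ A, v ∈ Tγ).Nonempty,
          truncatedWeight polyInc ρ C) -
        ∑ C ∈ (W.filter fun v => v ∈ V).powerset.powerset with
          (C ∩ (W.filter fun v => v ∈ V).powerset.filter fun A => ∃ v ∈ A, v ∈ Tγ).Nonempty,
          truncatedWeight polyInc ρ C) := by
    have h1 : (r : ℂ) = (((Zloop H (V \ Tγ) y : ℝ) : ℂ) / ((Zloop H V y : ℝ) : ℂ)) /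
        ((((Zloop H (S \ Tγ) y : ℝ) : ℂ)) / ((Zloop H S y : ℝ) : ℂ)) := by
      rw [hr]
      push_cast
      field_simp [hne (V \ Tγ), hne V, hne (S \ Tγ), hne S]
    rw [h1, hZ (V \ Tγ), hZ V, hZ (S \ Tγ), hZ S, powerset_filter_mem_diff W V Tγ,
      powerset_filter_mem_diff W S Tγ,
      powerset_sdiff_filter_eq_of_subset hTST (fun A => ∃ v ∈ A, v ∈ Tγ),
      polymerPartitionFunction_sdiff_div_eq_exp (hsmall.isKPVolume _),
      polymerPartitionFunction_sdiff_div_eq_exp (hsmall.isKPVolume _), ← Complex.exp_sub]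
    ring_nf
  -- abbreviate the two cluster sums
  obtain ⟨sV, hsV⟩ : ∃ sV : ℂ, sV = ∑ C ∈ (W.filter fun v => v ∈ V).powerset.powerset with
      (C ∩ (W.filter fun v => v ∈ V).powerset.filter fun A => ∃ v ∈ A, v ∈ Tγ).Nonempty,
      truncatedWeight polyInc ρ C := ⟨_, rfl⟩
  obtain ⟨sS, hsS⟩ : ∃ sS : ℂ, sS = ∑ C ∈ (W.filter fun v => v ∈ S).powerset.powerset with
      (C ∩ (W.filter fun v => v ∈ V).powerset.filter fun A => ∃ v ∈ A, v ∈ Tγ).Nonempty,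
      truncatedWeight polyInc ρ C := ⟨_, rfl⟩
  rw [← hsV, ← hsS] at hrC
  have hlog : Real.log r = (sS - sV).re := by
    have hnorm : r = Real.exp (sS - sV).re := by
      rw [← Complex.norm_exp, ← hrC, Complex.norm_real, Real.norm_eq_abs, abs_of_pos hrpos]
    rw [hnorm, Real.log_exp]
  -- the difference of the two cluster sums: clusters meeting `T` with a polymer not inside `S`
  have hsub : ((W.filter fun v => v ∈ S).powerset.powerset.filter fun C =>
      (C ∩ (W.filter fun v => v ∈ V).powerset.filter fun A => ∃ v ∈ A, v ∈ Tγ).Nonempty) ⊆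
      (W.filter fun v => v ∈ V).powerset.powerset.filter fun C =>
        (C ∩ (W.filter fun v => v ∈ V).powerset.filter fun A => ∃ v ∈ A, v ∈ Tγ).Nonempty :=
    Finset.filter_subset_filter _ (Finset.powerset_mono.2 (Finset.powerset_mono.2 hTST))
  have hdiff : sV - sS = ∑ C ∈ ((W.filter fun v => v ∈ V).powerset.powerset.filter fun C =>
      (C ∩ (W.filter fun v => v ∈ V).powerset.filter fun A => ∃ v ∈ A, v ∈ Tγ).Nonempty) \
      ((W.filter fun v => v ∈ S).powerset.powerset.filter fun C =>
        (C ∩ (W.filter fun v => v ∈ V).powerset.filter fun A => ∃ v ∈ A, v ∈ Tγ).Nonempty),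
      truncatedWeight polyInc ρ C := by
    rw [Finset.sum_sdiff_eq_sub hsub, hsV, hsS]
  -- finiteness of `V ∖ S`
  have hVfin : (V \ S).Finite :=
    ((finite_embMeshVertices_hex hΩ hδ0).subset (SAW.embMeshDomain_subset hexGraph hexCenter _ _)).subset
      Set.sdiff_subset
  -- every cluster of the difference passes through some `v ∈ γ` and some `w ∈ V ∖ S`
  have hmeet : ∀ C ∈ ((W.filter fun v => v ∈ V).powerset.powerset.filter fun C =>
      (C ∩ (W.filter fun v => v ∈ V).powerset.filter fun A => ∃ v ∈ A, v ∈ Tγ).Nonempty) \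
      ((W.filter fun v => v ∈ S).powerset.powerset.filter fun C =>
        (C ∩ (W.filter fun v => v ∈ V).powerset.filter fun A => ∃ v ∈ A, v ∈ Tγ).Nonempty),
      ∃ v ∈ γ.walk.support.toFinset, ∃ w ∈ hVfin.toFinset, v ∈ clusterSupp C ∧ w ∈ clusterSupp C := by
    intro C hC
    simp only [Finset.mem_sdiff, Finset.mem_filter, Finset.mem_powerset, not_and] at hC
    obtain ⟨⟨hCV, A', hA'⟩, hCS⟩ := hC
    obtain ⟨hA'C, hA'D⟩ := Finset.mem_inter.1 hA'
    obtain ⟨-, v, hvA', hvT⟩ := Finset.mem_filter.1 hA'D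
    have hCS' : ¬ C ⊆ (W.filter fun v => v ∈ S).powerset := fun h => hCS h ⟨A', hA'⟩
    obtain ⟨A, hAC, hATS⟩ := Finset.not_subset.1 hCS'
    obtain ⟨w, hwA, hwTS⟩ := Finset.not_subset.1 (fun h => hATS (Finset.mem_powerset.2 h))
    have hwTV : w ∈ W.filter fun v => v ∈ V := Finset.mem_powerset.1 (hCV hAC) hwA
    rw [Finset.mem_filter] at hwTV
    have hwS : w ∉ S := fun h => hwTS (Finset.mem_filter.2 ⟨hwTV.1, h⟩)
    exact ⟨v, List.mem_toFinset.2 hvT, w, hVfin.mem_toFinset.2 ⟨hwTV.2, hwS⟩,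
      mem_clusterSupp.2 ⟨A', hA'C, hvA'⟩, mem_clusterSupp.2 ⟨A, hAC, hwA⟩⟩
  -- assemble
  rw [hlog]
  calc |(sS - sV).re| ≤ ‖sS - sV‖ := Complex.abs_re_le_norm _
    _ = ‖sV - sS‖ := by rw [← norm_neg, neg_sub]
    _ ≤ ∑ C ∈ ((W.filter fun v => v ∈ V).powerset.powerset.filter fun C =>
            (C ∩ (W.filter fun v => v ∈ V).powerset.filter fun A => ∃ v ∈ A, v ∈ Tγ).Nonempty) \
          ((W.filter fun v => v ∈ S).powerset.powerset.filter fun C =>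
            (C ∩ (W.filter fun v => v ∈ V).powerset.filter fun A => ∃ v ∈ A, v ∈ Tγ).Nonempty),
          ‖truncatedWeight polyInc ρ C‖ := by
        rw [hdiff]
        exact norm_sum_le _ _
    _ ≤ ∑ v ∈ γ.walk.support.toFinset, ∑ w ∈ hVfin.toFinset,
          ∑ C ∈ (W.filter fun v => v ∈ V).powerset.powerset with (v ∈ clusterSupp C ∧ w ∈ clusterSupp C),
            ‖truncatedWeight polyInc ρ C‖ :=
        sum_filter_meets_le_sum_sum (Finset.sdiff_subset.trans (Finset.filter_subset _ _)) _ _ _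
          (fun _ => norm_nonneg _) hmeet
    _ ≤ ∑ v ∈ γ.walk.support.toFinset, ∑ w ∈ hVfin.toFinset,
          Real.exp (-((1 / 2) * (hexGraph.dist v w : ℝ))) :=
        Finset.sum_le_sum fun v _ => Finset.sum_le_sum fun w _ =>
          sum_norm_truncatedWeight_through_le hsmall hconn _ v w
    _ = ∑ v ∈ γ.walk.support.toFinset, ∑ᶠ w ∈ V \ S, Real.exp (-((1 / 2) * (hexGraph.dist v w : ℝ))) := by
        refine Finset.sum_congr rfl fun v _ => ?_
        rw [finsum_mem_eq_finite_toFinset_sum _ hVfin]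

/-- **Restriction from mass on `[0, 1/13]`** (cycle 4): the body of the route crux `RestrictionFromMass`
(stmt-CriticalPhenomena-7687) with `C = 1`, `c = ½`, for every `y ∈ [0, 1/13]` — its SmallFugacity layer
with an EXPLICIT range (`isSmallActivity_loopActivity_of_norm_le`, p160172). -/
theorem zloop_restrictionDefect_le_thirteenth :
    ∀ y ∈ Set.Icc (0 : ℝ) (1 / 13), ∀ (D : DobrushinDomain) (δ : ℝ), 0 < δ →
      ∀ (S : Set HexVertex) (a b : HexVertex) (γ : SAW.HexDomainSAW D.carrier δ a b),
        (∀ v ∈ γ.walk.support, v ∈ S) →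
          S ⊆ SAW.embMeshDomain hexGraph hexCenter D.carrier δ →
            |Real.log ((Zloop (SAW.hexDomainGraph D.carrier δ)
                  (SAW.embMeshDomain hexGraph hexCenter D.carrier δ \ {v | v ∈ γ.walk.support}) y *
                Zloop (SAW.hexDomainGraph D.carrier δ) S y) /
              (Zloop (SAW.hexDomainGraph D.carrier δ) (S \ {v | v ∈ γ.walk.support}) y *
                Zloop (SAW.hexDomainGraph D.carrier δ)
                  (SAW.embMeshDomain hexGraph hexCenter D.carrier δ) y))| ≤
              ∑ v ∈ γ.walk.support.toFinset,
                ∑ᶠ w ∈ SAW.embMeshDomain hexGraph hexCenter D.carrier δ \ S,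
                  Real.exp (-((1 / 2) * (hexGraph.dist v w : ℝ))) :=
  zloop_restrictionDefect_le_of_smallActivity isSmallActivity_loopActivity_of_norm_le

/-- The route-shaped form: `RestrictionFromMass`'s body with `C = 1`, `c = ½` on `[0, 1/13]`. -/
theorem restrictionFromMass_body_thirteenth :
    ∀ y ∈ Set.Icc (0 : ℝ) (1 / 13), ∃ C c : ℝ, 0 < c ∧
      ∀ (D : DobrushinDomain) (δ : ℝ), 0 < δ →
        ∀ (S : Set HexVertex) (a b : HexVertex) (γ : SAW.HexDomainSAW D.carrier δ a b),
          (∀ v ∈ γ.walk.support, v ∈ S) →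
            S ⊆ SAW.embMeshDomain hexGraph hexCenter D.carrier δ →
              |Real.log ((Zloop (SAW.hexDomainGraph D.carrier δ)
                    (SAW.embMeshDomain hexGraph hexCenter D.carrier δ \ {v | v ∈ γ.walk.support}) y *
                  Zloop (SAW.hexDomainGraph D.carrier δ) S y) /
                (Zloop (SAW.hexDomainGraph D.carrier δ) (S \ {v | v ∈ γ.walk.support}) y *
                  Zloop (SAW.hexDomainGraph D.carrier δ)
                    (SAW.embMeshDomain hexGraph hexCenter D.carrier δ) y))| ≤
                C * ∑ v ∈ γ.walk.support.toFinset,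
                  ∑ᶠ w ∈ SAW.embMeshDomain hexGraph hexCenter D.carrier δ \ S,
                    Real.exp (-(c * (hexGraph.dist v w : ℝ))) := by
  intro y hy
  refine ⟨1, 1 / 2, one_half_pos, fun D δ hδ S a b γ hγS hSV => ?_⟩
  rw [one_mul]
  exact zloop_restrictionDefect_le_thirteenth y hy D δ hδ S a b γ hγS hSV

end Summit.CriticalPhenomena.SAWScalingLimit.Theorems.SAWMassiveIsingTilt

end
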